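import Summits.QuantumFields.YangMills.Theorems.BalabanUVNodesN10B13KernelTowerWalksEntrywiseNumeralsDecoratedDials
import Literature.MathematicalPhysics.QuantumFieldTheory.Balaban1983to89.B13CondTowerAccretiveFloorMax
import Literature.MathematicalPhysics.QuantumFieldTheory.Balaban1983to89.B13CondTowerLocationNumerals

/-!
# BalabanUVNodes ∕ N10 AT THE DECORATED KERNEL TOWER OF RECORD — module 67RD's junction of [Balaban1988RG2Cluster] Lemmas 1–3 at the layer `lamD.toC.toK.layer`
# of a DECORATED residual layer `lamD : Node00.ResidB13D θ`, ALL-LOCATED EDITION («67RDL»): the EIGHT remaining NODE-A OBJECT-DATA binders of 67RD —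
# the fibre bounds `hfibN hKmult hfibF`, the far-ness `hKfar`, the geodesic letter `hGJ`, the averaging operator's `hCle hCsupp`, and the ONE positivity `hKacc` —
# REPLACED by located inequalities against the NAMED numerals of the record's own finite data (`B13CondTowerLocationNumerals.locNFibreMax ∕ sigmaDistFloor ∕
# locFFibreMax ∕ decorExcess ∕ cmAbsMax ∕ cmRange`, `B13CondTowerAccretiveFloorMax.accretiveFloorMax`) and two LAWS of the decoration data
# (Track A, DAG node N10 [B13]; D-0149 width seat `pub-ymgap-dag-n10-w4` g3 — the seat's g2 standing offer (t1) executed over 67RD (n10-w3 g2, p604591) = 67R (p599276)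
# = 67 (n10-c g13, p587126); supply lemmas n10-w4 g2 p594910 ∕ p597947 ∕ p599577 ∕ p602034 + g3 `B13CondTowerAccretiveFloorMax` ∕ `…LocationNumerals` v1.2 §6)

WHY (lane census `HOME/pub-ymgap-dag-n10-c/N10-RESIDUAL-CENSUS-v15∕v16.md`, class «ONE positivity `hKacc`» + the data-only halves of classes A2″ ∕ A2‴; lane line
«every NUMERAL-type binder of 67's NODE-A block is a located inequality — agreed»).  After 67R (the eleven junction-rate binders ⟹ ONE budget + ONE floor, n10-w3) and
67RD (the rung's twelve dial binders ⟹ print's TWO sources as two located inequalities, n10-w3), the junction of record still displayed EIGHT binders that are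
statements about the record's OWN finite object data `locN ∕ X ∕ locF ∕ J ∕ Cm ∕ K₀` and nothing else: `hfibN` (`#{j : locN j = x} ≤ m`), `hKmult` (`… ≤ rf.nB`),
`hKfar` (`rf.Rσ ≤ d₁(locN k, z)` for `z ∈ X`), `hfibF` (`#{k : locF k = y} ≤ mF`), `hGJ` (`GeodesicDecoration J locF X c₀ M₁`), `hCle` (`|C| ≤ 1`), `hCsupp`
(`C k i ≠ 0 → d₁(locF k, locN i) ≤ rC`) and `hKacc` (`rf.m₀·Σ‖vᵢ‖² ≤ Re⟨v, K(0,0)v⟩`).  `Literature/…/B13CondTowerLocationNumerals` and `…/B13CondTowerAccretiveFloor(Max)`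
(this seat, g2 ∕ g3) name, for each, the numeral of the record that decides it — the largest location fibres `locNFibreMax lamD.toC`, `locFFibreMax lamD`, the least
bond-to-σ-region distance `sigmaDistFloor lamD.toC`, the decoration's cardinal excess `decorExcess lamD M₁`, the averaging operator's largest entry `cmAbsMax lamD` and
range `cmRange lamD`, and the OPTIMAL accretive floor `accretiveFloorMax lamD.toC` of the real positive definite reference values `K₀ Z t` (the largest uniform
real Rayleigh floor; from the laws `hK₀ ∕ hpd` ALONE, compactness of the unit sphere, finiteness of the term index, closedness of the floor set) — with supply lemmas
concluding 67's binder TEXTS verbatim AND introduction rules the other way (`locNFibreMax_le_iff`, `locFFibreMax_le_iff`, `le_sigmaDistFloor`, `decorExcess_le_of_card_le`,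
`cmAbsMax_le_one_iff`, `cmRange_le_iff`, `le_accretiveFloorMax_iff`): the four binders 67 states over the WHOLE index (`hfibN hfibF hCle hCsupp`) are
EQUIVALENT to their located inequalities; for the four 67 restricts to print's terms `t ∈ terms … Z` (`hKmult hKfar hGJ hKacc`) the located inequality is the
equivalent of the ALL-INDEX form (a producer's data at non-term indices are expected trivial — as 67's own `hfibN hfibF hCle hCsupp` and the carrier's laws
`hpd hfib` already presume), and `hGJ`'s slope `M₁_pos` is derived, not assumed.  THIS FILE is 67RD so read: a consumer
supplies `hm hnB hRσfloor hmF hsymm hthrough hc₀ hCmax hrC hm₀` — ten ≤-inequalities ∕ laws about named numerals — instead of eight quantified binders; the decoration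
slope `0 < M₁` that `GeodesicDecoration` records is DERIVED from the thresholds already displayed (`hκ₁ hκp hP2 hηΔ`).

WHAT A CONSUMER OF THE N10 JUNCTION NOW SUPPLIES ABOUT NODE A's OBJECT DATA (after 67R ∕ 67RD ∕ this file): LAWS (`hKX` non-empty σ-regions, `hsymm ∕ hthrough` of the
decoration, `hPcard`), the ENTRYWISE LETTERS `hEL` of the σ-free fluctuation operators (open content: NODE 00's reading ∕ def-T's term tower ∕ N06's Thm 3.10 — the
lane's pencil chain 68–75 and n10-w2's inverse road are the located roads to it), and ≤-inequalities against NAMED numerals: w1's `theta0Max ∕ gamma2Max ∕ m4Min`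
(`hθ₀def hγle hM4`), w3's `kbarFloor` + budget (`hkbar hbudget`) and `radiusStar ∕ alphaMax ∕ rsigmaMin` (`hR₁def hαloc hRσloc`), and this seat's seven numerals
(`hm hnB hRσfloor hmF hc₀ hCmax hrC hm₀`) — each with its introduction rule.  No free-floating smallness binder about the record's data is left in the NODE-A block.

HONEST FRAMING.  Count-neutral kernel bookkeeping BY NAME over LANDED modules (67RD + the two numerals files of this seat); `lamD.Δ₀ ∕ lamD.J ∕ lamD.Cm ∕ lamD.locF ∕ lamD.P ∕
lamD.K₀` are DATA of the layer — NOTHING of Bałaban's `Δ_k`, `G_k(U)`, `Q`, averaging operators is constructed or asserted (NODE 00's reading ∕ N06's Sect.-B road ∕ def-Y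
own them); the numerals are finite-lattice numbers of the record's data over the WHOLE index type `B13TermIdx` (⊇ print's `terms … Z`, as 67's own `hfibN hfibF hCle
hCsupp` and the carrier's laws `hpd hfib` are stated) — in particular `accretiveFloorMax` is NOT print's k- and U-uniform `γ₀` ([Balaban1985BackgroundPropagators]
p. 428), which is N06's content; whether Bałaban's own reference package `rf`, fibre letters `m mF`, decoration letters `c₀ M₁` and averaging range `rC` MEET the ten
located inequalities is the located content, NOT claimed.  NODE A's ENTRYWISE letters `hEL`, the Lemma 1–2 located inputs about the HIDDEN frame (N09 ∕ N07 ∕ N06 in-edges),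
the reference package `rf` (NODE O's currency — `RefPackage`, `acrossSmall_of_walks_thresholds` UNTOUCHED) and the numerics REMAIN HYPOTHESES; dag-n10-d's ₁₃ pin algebra
(PIN-ALGEBRA ONE-DECLARER) untouched — the conclusion is the Stage-3-keyed `Node00.B13LeafOfRecord θ lamD.toC.toK.layer` BY NAME.  N10 NOT discharged; K1⁷ NOT closed;
counts unmoved; one finite four-torus programme at fixed ε per run; nothing continuum ∕ ℝ⁴ ∕ OS ∕ mass-gap ∕ Clay.  0 `sorry`, 0 `def`, standard axioms.  Filed
`--kind proof --supports` K1⁷ «StabilityBAtRecordR13SepCoPH» (stmt-QuantumFields-20542) `--as helper` of route «BalabanUVNodes».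

WHAT THIS FILE PROVES.  §1 `b13LeafOfRecord_decLayer_of_located_entrywise_numerals_dials_located` ⟹ `B13LeafOfRecord θ lamD.toC.toK.layer`.  Generated from 67RD's
signature (binders parsed; the eight replaced by ten; proof = `0 < M₁` from the displayed thresholds + the eight supply terms, then 67RD positionally — 107 explicit binders).

References (TYPES and page anchors only): [II] = [Balaban1988RG2Cluster] Lemma 1 p.9, Lemma 2 p.11, Lemma 3 p.20, p.3, (1.11) p.5, (2.3) p.12, (2.5)–(2.8) pp.12–14, p.13,
p.15, (2.14)–(2.26) pp.15–17, p.21; [I] = [Balaban1987RG1] (1.11)–(1.14) p.262; [B9] = [Balaban1985BackgroundPropagators] Thm 3.10 (3.107)–(3.108) p.416, Thm 3.12 p.423,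
p.428; [Balaban1984PropagatorsII] Lemma 2.1 (2.61) p.234.
A2 ∕ A6 (director-ym №189 STANDING A6 RULE).  Each of the ten new hypotheses is individually inhabited at the record's own numerals — `m := locNFibreMax lamD.toC`,
`mF := locFFibreMax lamD`, `c₀ := decorExcess lamD M₁`, `rC := cmRange lamD` (`le_rfl`), and the three `rf`-facing ones `hnB hRσfloor hm₀` by any letters with
`locNFibreMax ≤ nB`, `Rσ ≤ sigmaDistFloor` (`sigmaDistFloor_nonneg`), `m₀ ≤ accretiveFloorMax` (`accretiveFloorMax_pos`: a POSITIVE margin is available); `hCmax` and the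
laws `hsymm hthrough` are CHECKS on the data `Cm ∕ J ∕ locF ∕ X` (true for print's averaging weights and cube decorations, NOT implied by `ResidB13D`'s laws — LOCATED).
Jointly, `hRσloc` and `hRσfloor` pin `rf.Rσ` into `[rsigmaMin θ₀ …, sigmaDistFloor lamD.toC]` — print's «σ-cubes sufficiently far from the bonds of the term» ([II] p. 13)
AT THE RECORD's data: located content, NOT claimed.  67RD's ∕ 67R's ∕ 67's block-by-block inhabitants stand with the same HONEST LIMITS (no single inhabitant of all binders
at once; the hidden-frame inputs inhabited by the zero tower).
VACUITY NOTE (v1.0.1 docstring-only edition, 2026-08-28; lane word of dag-n10-c g15, cell bus I.31365; seat `pub-ymgap-dag-n10-w4` g4).  dag-n10-w3's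
`Literature/…/Balaban1983to89/B13CountBinderObstruction` (p612518: `no_joint_inhabitant_of_consts ∕ _constsQ8 ∕ _constsQ8A`, `count_binders_false_of_delta_kappa_le`)
proves that THREE of the binders displayed below — the θ-FREE count form `hcount` (module 64's adoption of w1's `vol_of_counts` coarsening: per-row-bond cost frozen at
its worst case), `hPcard` and the numerics `hN` (`Lemma3Numerics`) — are NOT JOINTLY INHABITABLE at any constants family typed in the tree: at `Z` = the whole coarse
torus and the admissible term `(∅, all bonds)` they force `1280·(m₃+1)⁴·L³ < δ·κ`, while every typed family (`consts`, `constsQ8 M`, `constsQ8A M α₄`) has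
`δ·κ < 672`.  CONSEQUENCES: (i) this theorem (and 64 ∕ 67 ∕ 67R ∕ 67RD, which display the same three binders) stays TRUE AS STATED — it is an implication — but its
hypothesis list has NO joint inhabitant at the tree's constants families, so it must not be read as evidence that the N10 junction is met there; (ii) the located-object
supply lemmas of this lineage (`B13CondTowerLocationNumerals`, `B13CondTowerAccretiveFloor(Max)`) are unaffected and are re-applied verbatim in the lane's DISPLAY OF
RECORD, dag-n10-w3's sibling edition «67V» `…EntrywiseNumeralsDecoratedDialsLocatedVol` (p614443), which displays 51C's DIAL-WEIGHTED volume binder `hvol` (coefficients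
carrying `θ₀ ∕ γ₂ ∕ α₄M⁻⁴`, `θ₀ ≤ θ₀max` free; `dialCount_le_of_dials`) instead of `hcount` — consumers should key on 67V; (iii) nothing of print is touched: [II] p. 20's
volume factor is the dial-weighted `O(1)(LM)⁴α₅` with `α₅` small, which is exactly 51C's `hvol`; the artefact was the θ-free coarsening adopted as a BINDER.  Code below
byte-identical to edition 1 (p607696).
-/

noncomputable section

namespace Summit.QuantumFields.YangMills.BalabanUVNodes.N10B13KernelTowerWalksEntrywiseNumeralsDecoratedDialsLocated

open Literature.MathematicalPhysics.QuantumFieldTheory.Balaban1983to89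
open Literature.MathematicalPhysics.QuantumFieldTheory.Balaban1983to89.DagBinding
open Literature.MathematicalPhysics.QuantumFieldTheory.Balaban1983to89.Node00
open Literature.MathematicalPhysics.QuantumFieldTheory.Balaban1983to89.B13Lemma3Torus (TwoTorusStep)
open Literature.MathematicalPhysics.QuantumFieldTheory.Balaban1983to89.B13Lemma3TorusSocket (TermDomination Lemma3Numerics)
open Literature.MathematicalPhysics.QuantumFieldTheory.Balaban1983to89.B13Lemma3TorusData
open Metric
open Literature.MathematicalPhysics.QuantumFieldTheory.Balaban1983to89.B16Absorption (pbox)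
open Literature.MathematicalPhysics.QuantumFieldTheory.Balaban1983to89.TreeLengthTorus
open Literature.MathematicalPhysics.QuantumFieldTheory.Balaban1983to89.TreeLengthTorusGeometry
open Literature.MathematicalPhysics.QuantumFieldTheory.Balaban1983to89.TreeLengthTorusTransfer
open Literature.MathematicalPhysics.QuantumFieldTheory.Balaban1983to89.B12TreeDecay (kappa₀ K₀)
open Literature.MathematicalPhysics.QuantumFieldTheory.Balaban1983to89.B13PkScaling (Qop scaled)
open Literature.MathematicalPhysics.QuantumFieldTheory.Balaban1983to89.B13Bound143 (invTau R12)
open Literature.MathematicalPhysics.QuantumFieldTheory.Balaban1983to89.B13Term214 (term214 SepHolOn core214 F214)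
open Literature.MathematicalPhysics.QuantumFieldTheory.Balaban1983to89.B13Lemma3TorusTerms (terms Z0)
open Literature.MathematicalPhysics.QuantumFieldTheory.Balaban1983to89.B5TorusCover (UT)
open Literature.MathematicalPhysics.QuantumFieldTheory.Balaban1983to89.B13TermWalkData (TermKernels)
open Literature.MathematicalPhysics.QuantumFieldTheory.Balaban1983to89.NodeOLettersOfWalksAcross (WalkPackage TermWalks)
open Literature.MathematicalPhysics.QuantumFieldTheory.Balaban1983to89.NodeOLettersOfWalksPerturbative (RefPackage TermWalksRef)
open Literature.MathematicalPhysics.QuantumFieldTheory.Balaban1983to89.B13Sqrt27Accretive (invSqrt)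
open Literature.MathematicalPhysics.QuantumFieldTheory.Balaban1983to89.B9Thm37GlueTorus (tdist1)
open Literature.MathematicalPhysics.QuantumFieldTheory.Balaban1983to89.B13Eq111SDecoupling (sDecorate)
open Literature.MathematicalPhysics.QuantumFieldTheory.Balaban1983to89.B13EntrywiseWalks (RawEntryLetters GeodesicDecoration rawEntryTerm)
open scoped Matrix
open Literature.MathematicalPhysics.QuantumFieldTheory.Balaban1983to89.B13Bound226Numerals (theta0Max gamma2Max m4Min)
open Literature.MathematicalPhysics.QuantumFieldTheory.Balaban1983to89.B13EntrywiseBlockNumerals (kbarFloor)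
open Literature.MathematicalPhysics.QuantumFieldTheory.Balaban1983to89.B13RungDialNumerals (radiusStar alphaMax rsigmaMin)
open Summit.QuantumFields.YangMills.BalabanUVNodes.N10B13KernelTowerWalksEntrywiseNumeralsDecoratedDials
  (b13LeafOfRecord_decLayer_of_located_entrywise_numerals_dials)
open Literature.MathematicalPhysics.QuantumFieldTheory.Balaban1983to89.B13CondTowerAccretiveFloorMax (accretiveFloorMax hKacc_decTower_of_le_accretiveFloorMax)
open Literature.MathematicalPhysics.QuantumFieldTheory.Balaban1983to89.B13CondTowerLocationNumerals
  (locNFibreMax sigmaDistFloor locFFibreMax decorExcess cmAbsMax cmRange hfibN_decTower_of_le hKmult_decTower_of_le hKfar_decTower_of_le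
    hfibF_of_locFFibreMax_le hGJ_of_laws_of_decorExcess_le hCle_of_cmAbsMax_le_one hCsupp_of_cmRange_le)

/-! ## §1. THE ENTRYWISE JUNCTION AT THE DECORATED TOWER, ALL-LOCATED EDITION — rates budgeted (67R), the rung's dials located (67RD), and the eight
NODE-A object-data binders located against the named numerals of the record's own finite data (this file) -/

section DecLayer

variable (θ : Stage3Params) (lamD : ResidB13D θ)

-- the junction elaborates ≈ 150 binders and a 160–170-argument application; twice the default budget (as the source junctions 67 ∕ 67R ∕ 67RD)
set_option maxHeartbeats 400000 in
open Classical in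
/-- **THE [B13] LEAF AT THE DECORATED KERNEL TOWER OF RECORD (ENTRYWISE, ALL-LOCATED EDITION).**  Module 67RD's
`b13LeafOfRecord_decLayer_of_located_entrywise_numerals_dials` with its EIGHT remaining NODE-A OBJECT-DATA binders REPLACED by located inequalities against the
NAMED numerals of the record's own finite data `locN ∕ X ∕ locF ∕ J ∕ Cm ∕ K₀` (n10-w4 g2∕g3, `B13CondTowerLocationNumerals` ∕ `B13CondTowerAccretiveFloorMax`, BY NAME):
`hfibN` ↦ `hm : locNFibreMax lamD.toC ≤ m` · `hKmult` ↦ `hnB : locNFibreMax lamD.toC ≤ rf.nB` · `hKfar` ↦ `hRσfloor : rf.Rσ ≤ sigmaDistFloor lamD.toC` ·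
`hfibF` ↦ `hmF : locFFibreMax lamD ≤ mF` · `hGJ` ↦ the two LAWS `hsymm` (symmetric decoration) and `hthrough` (a decorated pair is joined by a `d₁`-geodesic through
the σ-region) + `hc₀ : decorExcess lamD M₁ ≤ c₀` (the slope `0 < M₁` is DERIVED from `hκ₁ hκp hP2 hηΔ`) · `hCle` ↦ `hCmax : cmAbsMax lamD ≤ 1` ·
`hCsupp` ↦ `hrC : cmRange lamD ≤ rC` · `hKacc` ↦ `hm₀ : rf.m₀ ≤ accretiveFloorMax lamD.toC` (the OPTIMAL uniform real Rayleigh floor `> 0` of the positive definite reference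
values `K₀ Z t`, from the laws `hK₀ ∕ hpd` alone; any known uniform floor `γ ≥ rf.m₀` discharges it, `le_accretiveFloorMax_of_rayleighFloor`).  Every other binder VERBATIM 67RD's, in its order (w3's `hR₁def hp hη hθ₀def hαloc hRσloc hbudget hkbar`, w1's
`hγle hM4` included); conclusion `B13LeafOfRecord θ lamD.toC.toK.layer` BY NAME.  NOTHING LOST: each replaced binder FOLLOWS from its located inequality by the supply lemma
named, and the numerals bound exactly the quantities the binders quantify over (`card_locN_fibre_le`, `card_locF_fibre_le`, `sigmaDistFloor_le`, `ceil_le_decorExcess`,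
`abs_cm_le_cmAbsMax`, `tdist1_le_cmRange`, `rayleighFloor_accretiveFloorMax`) — SHARPLY: the introduction rules `locNFibreMax_le_iff`,
`locFFibreMax_le_iff`, `le_sigmaDistFloor`, `decorExcess_le_of_card_le`, `cmAbsMax_le_one_iff`, `cmRange_le_iff`, `le_accretiveFloorMax_iff` recover each located
inequality from the ALL-INDEX form of the binder it replaces (literally equivalent for `hfibN hfibF hCle hCsupp`, which 67 states over the whole index; the
all-index strengthening for `hKmult hKfar hGJ hKacc`, which 67 restricts to print's terms `t ∈ terms … Z`).  Count-neutral: hypotheses about the HIDDEN frame, NODE A's letters `hEL`, NODE O's package `rf` and the numerics remain; nothing of Bałaban's is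
asserted; `accretiveFloorMax` is a finite-lattice number, NOT print's k-∕U-uniform `γ₀`.  VACUITY NOTE (v1.0.1): `hN ∧ hPcard ∧ hcount` below are NOT jointly
inhabitable at any constants family typed in the tree (dag-n10-w3's `B13CountBinderObstruction.no_joint_inhabitant_of_consts ∕ _constsQ8 ∕ _constsQ8A`, p612518) — the
theorem is TRUE AS STATED but vacuous there; the lane's DISPLAY OF RECORD is the sibling «67V» `…EntrywiseNumeralsDecoratedDialsLocatedVol` (p614443, dial-weighted `hvol`
in place of `hcount`); see the module docstring.
[cite: Balaban1988RG2Cluster, Lemma 1 p.9, Lemma 2 p.11, Lemma 3 p.20, p.3, (1.11) p.5, (2.3) p.12, (2.5)–(2.8) pp.12–14, p.13, (2.14)–(2.26) pp.15–17, p.15;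
Balaban1987RG1, (1.11)–(1.14) p.262; Balaban1985BackgroundPropagators, Thm 3.10 (3.107)–(3.108) p.416, Thm 3.12 p.423, p.428; Balaban1984PropagatorsII, Lemma 2.1 (2.61) p.234] -/
theorem b13LeafOfRecord_decLayer_of_located_entrywise_numerals_dials_located
    (hN12 : 12 ≤ (θ.ℓ₆ + 1) * (lamD.toC.toK.layer.n + 1))
    -- (1) LEMMA 1: [I]'s block geometry of the (1.33) index families of the layer
    (dist : TDom 4 ((θ.ℓ₆ + 1) * (lamD.toC.toK.layer.n + 1)) → TPt 4 ((θ.ℓ₆ + 1) * (lamD.toC.toK.layer.n + 1)) → (j : ℕ) →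
      TPt 4 ((θ.ℓ₆ + 1) ^ (lamD.toC.toK.layer.k - j) * ((θ.ℓ₆ + 1) * (lamD.toC.toK.layer.n + 1))) → ℝ)
    {K K' : ℝ}
    (hS0Y : ∀ Y, ∀ a ∈ lamD.toC.toK.layer.S0 Y,
      (pbox (fun i => natLift a i - (5 : ℕ)) (fun i => natLift a i + 1 + (5 : ℕ))).image (proj ((θ.ℓ₆ + 1) * (lamD.toC.toK.layer.n + 1))) ⊆ Y.1)
    (hFsub : ∀ Y a, lamD.toC.toK.layer.F Y a ⊆
      (pbox (fun i => natLift a i - (5 : ℕ)) (fun i => natLift a i + 1 + (5 : ℕ))).image (proj ((θ.ℓ₆ + 1) * (lamD.toC.toK.layer.n + 1))) \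
        (pbox (fun i => natLift a i - (4 : ℕ)) (fun i => natLift a i + 1 + (4 : ℕ))).image (proj ((θ.ℓ₆ + 1) * (lamD.toC.toK.layer.n + 1))))
    (hSq : ∀ Y, ∀ a ∈ lamD.toC.toK.layer.S0 Y, ∀ j, lamD.toC.toK.layer.Sq Y a j ⊆
      (Finset.univ : Finset (TPt 4 ((θ.ℓ₆ + 1) ^ (lamD.toC.toK.layer.k - j) * ((θ.ℓ₆ + 1) * (lamD.toC.toK.layer.n + 1))))).filter
        (fun q => tcoarse ((θ.ℓ₆ + 1) ^ (lamD.toC.toK.layer.k - j)) ((θ.ℓ₆ + 1) * (lamD.toC.toK.layer.n + 1)) q ∈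
          (pbox (fun i => natLift a i - (2 : ℕ)) (fun i => natLift a i + 1 + (2 : ℕ))).image (proj ((θ.ℓ₆ + 1) * (lamD.toC.toK.layer.n + 1)))))
    (hScY : ∀ Y, lamD.toC.toK.layer.Sc Y ⊆ Y.1) (hdist0 : ∀ Y a j q, 0 ≤ lamD.toC.toK.layer.c.δ₀ * dist Y a j q)
    (hdist : ∀ Y a j (n : ℕ) q, q ∉ (pbox (fun i => (((θ.ℓ₆ + 1) ^ (lamD.toC.toK.layer.k - j) : ℕ) : ℤ) * natLift a i - (n + 1 : ℕ))
      (fun i => (((θ.ℓ₆ + 1) ^ (lamD.toC.toK.layer.k - j) : ℕ) : ℤ) * natLift a i + 2 * (((θ.ℓ₆ + 1) ^ (lamD.toC.toK.layer.k - j) : ℕ) : ℤ) - 1 + (n + 1 : ℕ))).image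
        (proj ((θ.ℓ₆ + 1) ^ (lamD.toC.toK.layer.k - j) * ((θ.ℓ₆ + 1) * (lamD.toC.toK.layer.n + 1)))) → lamD.toC.toK.layer.c.δ₀ * lamD.toC.toK.layer.c.M * ((n : ℝ) + 1) ≤ lamD.toC.toK.layer.c.δ₀ * dist Y a j q)
    (hSX : ∀ Y a j q, lamD.toC.toK.layer.SX Y a j q ⊆ (tcubeSys 4 ((θ.ℓ₆ + 1) ^ (lamD.toC.toK.layer.k - j) * ((θ.ℓ₆ + 1) * (lamD.toC.toK.layer.n + 1)))).above q)
    (hSX' : ∀ Y a j q, lamD.toC.toK.layer.SX' Y a j q ⊆ (tcubeSys 4 ((θ.ℓ₆ + 1) ^ (lamD.toC.toK.layer.k - j) * ((θ.ℓ₆ + 1) * (lamD.toC.toK.layer.n + 1)))).above q)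
    (hX0 : ∀ Y, ∀ a ∈ lamD.toC.toK.layer.Sc Y, ∀ j ∈ Finset.range (lamD.toC.toK.layer.k + 1), ∀ q ∈ lamD.toC.toK.layer.Sq' Y a j, ∀ x ∈ lamD.toC.toK.layer.SX' Y a j q,
      x.1.image (tcoarse ((θ.ℓ₆ + 1) ^ (lamD.toC.toK.layer.k - j)) ((θ.ℓ₆ + 1) * (lamD.toC.toK.layer.n + 1))) ⊆ Y.1)
    -- (1) LEMMA 1: per-term analyticity on (1.34)
    (hAnT : ∀ Y, ∀ a ∈ lamD.toC.toK.layer.S0 Y, ∀ X ∈ (lamD.toC.toK.layer.F Y a).powerset, ∀ j ∈ Finset.range (lamD.toC.toK.layer.k + 1), ∀ q ∈ lamD.toC.toK.layer.Sq Y a j,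
      ∀ x ∈ lamD.toC.toK.layer.SX Y a j q, AnalyticOnNhd ℂ (lamD.toC.toK.layer.T Y a X j q x) (lamD.toC.toK.layer.sp1 Y))
    (hAnT' : ∀ Y, ∀ a ∈ lamD.toC.toK.layer.Sc Y, ∀ j ∈ Finset.range (lamD.toC.toK.layer.k + 1), ∀ q ∈ lamD.toC.toK.layer.Sq' Y a j, ∀ x ∈ lamD.toC.toK.layer.SX' Y a j q,
      AnalyticOnNhd ℂ (lamD.toC.toK.layer.T' Y a j q x) (lamD.toC.toK.layer.sp1 Y))
    -- (1) LEMMA 1: thresholds and restrictions on the residual constants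
    (hK : 0 ≤ K) (hK' : 0 ≤ K') (hκ : 0 ≤ lamD.toC.toK.layer.c.κ) (hδ1 : lamD.toC.toK.layer.c.δ < 1)
    (hδκ : 1 ≤ lamD.toC.toK.layer.c.δ * lamD.toC.toK.layer.c.κ) (hκ126 : kappa₀ 64 8 ≤ lamD.toC.toK.layer.c.κ)
    (hκ126' : kappa₀ 64 8 ≤ lamD.toC.toK.layer.c.δ * lamD.toC.toK.layer.c.κ) (hκ₁ : 1 + 2 * Real.log (8 * 12 ^ 3) ≤ lamD.toC.toK.layer.c.κ₁)
    (hκ₁' : 2 + 16 * Real.log 128 ≤ lamD.toC.toK.layer.c.κ₁) (hδ₀M : 10 * Real.exp (-1) ≤ lamD.toC.toK.layer.c.δ₀ * lamD.toC.toK.layer.c.M)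
    (hδ₀M5 : 2 * Real.log 5 ≤ lamD.toC.toK.layer.c.δ₀ * lamD.toC.toK.layer.c.M)
    (hR8 : (1 - lamD.toC.toK.layer.c.δ) * lamD.toC.toK.layer.c.κ ≤ (1 / 4) * (lamD.toC.toK.layer.c.κ₁ - 1))
    (hR9 : (1 - 2 * lamD.toC.toK.layer.c.δ) * lamD.toC.toK.layer.c.κ ≤ (1 / 16) * lamD.toC.toK.layer.c.κ₁)
    -- (1) LEMMA 1: per-term (1.24), (1.30) by reference to [I] (3.54), (3.17), [15] Prop. 4, [13] (3.108); the constants with headroom (1 − θ₁)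
    (h124 : ∀ Y φ, φ ∈ lamD.toC.toK.layer.sp1 Y → ∀ a ∈ lamD.toC.toK.layer.S0 Y, ∀ X ∈ (lamD.toC.toK.layer.F Y a).powerset, ∀ j ∈ Finset.range (lamD.toC.toK.layer.k + 1), ∀ q ∈ lamD.toC.toK.layer.Sq Y a j,
      ∀ x ∈ lamD.toC.toK.layer.SX Y a j q,
        ‖lamD.toC.toK.layer.T Y a X j q x φ‖ ≤ K * (((θ.ℓ₆ + 1 : ℕ) : ℝ) ^ j * (((θ.ℓ₆ + 1 : ℕ) : ℝ) ^ lamD.toC.toK.layer.k)⁻¹) ^ 5 *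
          Real.exp (-(lamD.toC.toK.layer.c.κ₁ - 1) *
            (((Y.1 \ (pbox (fun i => natLift a i - (5 : ℕ)) (fun i => natLift a i + 1 + (5 : ℕ))).image
              (proj ((θ.ℓ₆ + 1) * (lamD.toC.toK.layer.n + 1)))).card : ℝ) + X.card)) *
          Real.exp (-(lamD.toC.toK.layer.c.κ * torusTreeLen x.1)))
    (h130 : ∀ Y φ, φ ∈ lamD.toC.toK.layer.sp1 Y → ∀ a ∈ lamD.toC.toK.layer.Sc Y, ∀ j ∈ Finset.range (lamD.toC.toK.layer.k + 1), ∀ q ∈ lamD.toC.toK.layer.Sq' Y a j,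
      ∀ x ∈ lamD.toC.toK.layer.SX' Y a j q,
        ‖lamD.toC.toK.layer.T' Y a j q x φ‖ ≤ K' * Real.exp (-(1 / 2) * (lamD.toC.toK.layer.c.δ₀ * lamD.toC.toK.layer.c.M) * (((θ.ℓ₆ + 1 : ℕ) : ℝ) ^ j * (((θ.ℓ₆ + 1 : ℕ) : ℝ) ^ lamD.toC.toK.layer.k)⁻¹)⁻¹
            - (1 / 2) * lamD.toC.toK.layer.c.δ₀ * dist Y a j q) *
          Real.exp (-(lamD.toC.toK.layer.c.κ₁ - 1) * ((Y.1 \ x.1.image (tcoarse ((θ.ℓ₆ + 1) ^ (lamD.toC.toK.layer.k - j)) ((θ.ℓ₆ + 1) * (lamD.toC.toK.layer.n + 1)))).card : ℝ)) *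
          Real.exp (-(lamD.toC.toK.layer.c.κ * torusTreeLen x.1)))
    {θ₁ : ℝ} (hθ₁0 : 0 ≤ θ₁) (hθ₁1 : θ₁ < 1)
    (hC : K * K₀ 64 8 * (2 * (6 * ((θ.ℓ₆ + 1 : ℕ) : ℝ)) ^ 4) * Real.exp 1 * Real.exp ((1 / 8) * lamD.toC.toK.layer.c.κ₁ * (12 ^ 4 - 1)) +
        2 * (64 * K') * K₀ 64 8 * 1344 ≤
      (1 - θ₁) * (lamD.toC.toK.layer.c.E₀ * lamD.toC.toK.layer.c.ε₁ * lamD.toC.toK.layer.c.C₁ * lamD.toC.toK.layer.c.M ^ lamD.toC.toK.layer.c.q * Real.exp (lamD.toC.toK.layer.c.C₂ * lamD.toC.toK.layer.c.κ₁)))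
    -- (2) LEMMA 2 (pp. 10–11): the curvature terms; the located per-term data of `B13Lemma2Torus.lemma2Printed_twoTorus'` for the layer's plaquette data
    (hGlAn : ∀ Y, AnalyticOnNhd ℂ (lamD.toC.toK.layer.Gl Y) (lamD.toC.toK.layer.sp1 Y))
    (hGl : ∀ Y φ, φ ∈ lamD.toC.toK.layer.sp1 Y → ‖lamD.toC.toK.layer.Gl Y φ‖ ≤ θ₁ * (lamD.toC.toK.layer.c.E₀ * lamD.toC.toK.layer.c.ε₁ * lamD.toC.toK.layer.c.C₁ * lamD.toC.toK.layer.c.M ^ lamD.toC.toK.layer.c.q * Real.exp (lamD.toC.toK.layer.c.C₂ * lamD.toC.toK.layer.c.κ₁)) *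
      Real.exp (-((1 - 2 * lamD.toC.toK.layer.c.δ) * lamD.toC.toK.layer.c.κ * (tsys 4 ((θ.ℓ₆ + 1) * (lamD.toC.toK.layer.n + 1))).dj Y)))
    (he : ∀ Y b, ‖lamD.toC.toK.layer.e Y b‖ ≤ 1) (hg : lamD.toC.toK.layer.g ≠ 0) {R K₂ : ℝ} {m₂ : ℕ} (hK₂ : 0 ≤ K₂) (hR : 0 < R)
    (hε3 : 3 * lamD.toC.toK.layer.c.ε₁ ≤ R)
    (hW : ∀ Y, ∀ i ∈ lamD.toC.toK.layer.s Y, ∀ φ ∈ lamD.toC.toK.layer.sp1 Y, AnalyticOnNhd ℂ (lamD.toC.toK.layer.Wf Y i φ) (ball 0 R))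
    (hKW : ∀ Y, ∀ i ∈ lamD.toC.toK.layer.s Y, ∀ φ ∈ lamD.toC.toK.layer.sp1 Y, ∀ z ∈ ball (0 : lamD.toC.toK.layer.E) R,
      ‖lamD.toC.toK.layer.Wf Y i φ z‖ ≤ K₂ * Real.exp (-(lamD.toC.toK.layer.c.κ₁ - 1) * ((Y.1.card : ℝ) - 1)) * ‖z‖ ^ 3)
    (hcard : ∀ Y, (lamD.toC.toK.layer.s Y).card ≤ m₂ * Y.1.card)
    (hsp : ∀ Y φ, φ ∈ lamD.toC.toK.layer.sp1 Y → ‖lamD.toC.toK.layer.g‖ * ‖lamD.toC.toK.layer.rd Y φ‖ < lamD.toC.toK.layer.c.ε₁)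
    (hfloor : 27 * m₂ * K₂ * Real.exp (lamD.toC.toK.layer.c.κ₁ - 1) ≤ lamD.toC.toK.layer.c.C₃ * lamD.toC.toK.layer.c.M ^ 4 * Real.exp (lamD.toC.toK.layer.c.C₂ * lamD.toC.toK.layer.c.κ₁))
    (hAnP : ∀ Y, ∀ i ∈ lamD.toC.toK.layer.s Y, AnalyticOnNhd ℂ (fun φ => scaled lamD.toC.toK.layer.g (lamD.toC.toK.layer.Wf Y i φ) (lamD.toC.toK.layer.rd Y φ)) (lamD.toC.toK.layer.sp1 Y))
    (hG : ∀ Y, lamD.toC.toK.layer.GaugeInv (lamD.toC.toK.layer.V Y) ∧ lamD.toC.toK.layer.GaugeInv ((WtOfRecord θ lamD.toC.toK.layer).toStepData.quadForm Y) ∧ lamD.toC.toK.layer.GaugeInv (lamD.toC.toK.layer.Vpp Y))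
    -- (3) LEMMA 3 (pp. 14–20): the signs of (2.18)–(2.20), R12, |τ(Y)| ≥ 2, and the numerics bundle at ℓ = ½L
    (hL8 : 8 ≤ θ.ℓ₆ + 1) {a a₂ a₂' a₅ Aabs : ℝ}
    (hN : Lemma3Numerics (c13OfRecord θ lamD.toC.toK.layer) (lamD.toC.toK.layer.m₃ + 1) (((θ.ℓ₆ + 1 : ℕ) : ℝ) / 2) a a₂ a₂' a₅ Aabs)
    (h12 : R12 (c13OfRecord θ lamD.toC.toK.layer)) (hE : 0 < lamD.toC.toK.layer.c.E₀) (hε : 0 < lamD.toC.toK.layer.c.ε₁)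
    (hC₁ : 0 < lamD.toC.toK.layer.c.C₁) (hα : 0 < lamD.toC.toK.layer.c.α₄) (hM : 1 ≤ lamD.toC.toK.layer.c.M)
    (hτ2 : lamD.toC.toK.layer.c.E₀ * lamD.toC.toK.layer.c.ε₁ * lamD.toC.toK.layer.c.C₁ * lamD.toC.toK.layer.c.α₄⁻¹ * lamD.toC.toK.layer.c.M ^ lamD.toC.toK.layer.c.q * Real.exp (lamD.toC.toK.layer.c.C₂ * lamD.toC.toK.layer.c.κ₁) ≤ 1 / 2)
    -- (3) the Cauchy radius and the parameter domains (p. 15)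
    -- the bigger σ-polydisc (a second constants record `cp` lending its `κ₁`; NODE A's kernels are tagged at `cp`) and a
    -- Cauchy radius `r ≤ 1`; the τ-regions are the open discs of radii `2|τ(Y)|` (chosen inside)
    (cp : B13.Consts) (hκp : lamD.toC.toK.layer.c.κ₁ < cp.κ₁) (hr : 0 < lamD.toC.toK.r) (hr1 : lamD.toC.toK.r ≤ 1)
    -- (3) THE DICTIONARY IS def-B13's KERNEL TOWER (`lamD.toC.toK.𝒦 ∕ uOf ∕ r ∕ lZ ∕ lD ∕ Gam ∕ chiY₀ ∕ chicP ∕ Pl ∕ rP ∕ Vr ∕ emb`, `Dfam := 𝐃`; `Γ(σ) = G(σ)·` is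
    --     `ResidB13K.Gam_eq`): only the configuration size `α` and the `|P|` row-bond count stay located
    {α : ℝ} (hαnn : 0 ≤ α)
    (huα : ∀ Z, ∀ t ∈ terms (θ.ℓ₆ + 1) (lamD.toC.toK.layer.m₃ + 1) Z, ∀ φ ∈ lamD.toC.toK.layer.sp2 Z, ‖lamD.toC.toK.uOf Z t φ‖ ≤ α)
    (hPcard : ∀ Z, ∀ t ∈ terms (θ.ℓ₆ + 1) (lamD.toC.toK.layer.m₃ + 1) Z, (lamD.toC.toK.Pl Z t).card = t.2.card)
    -- (3) the record's objects behind the terms: bonds, cubes, the real field inside the configurations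
    (ιb : (Z : TDom 4 (lamD.toC.toK.layer.n + 1)) → (t : Finset (TDom 4 ((θ.ℓ₆ + 1) * (lamD.toC.toK.layer.n + 1))) × Finset (TBond 4 (lamD.toC.toK.layer.m₃ + 1) ((θ.ℓ₆ + 1) * (lamD.toC.toK.layer.n + 1)))) → (lamD.toC.toK.𝒦 Z t).Λ → lamD.toC.toK.layer.Bond)
    (hι : ∀ Z t, Function.Injective (ιb Z t)) (cube : lamD.toC.toK.layer.Bond → TPt 4 ((θ.ℓ₆ + 1) * (lamD.toC.toK.layer.n + 1)))
    (hQsupp : ∀ (Y : TDom 4 ((θ.ℓ₆ + 1) * (lamD.toC.toK.layer.n + 1))) φ b b', lamD.toC.toK.layer.Q Y φ b b' ≠ 0 → cube b ∈ Y.1 ∧ cube b' ∈ Y.1) {m' : ℕ}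
    (hfibc : ∀ Z t (x : TPt 4 ((θ.ℓ₆ + 1) * (lamD.toC.toK.layer.n + 1))), (Finset.univ.filter fun j => cube (ιb Z t j) = x).card ≤ m')
    (hBv : ∀ Z t φ B b, lamD.toC.toK.layer.Bv (lamD.toC.toK.emb Z t φ B) (ιb Z t b) = (B b : ℂ))
    (hBv0 : ∀ Z t φ B b', b' ∉ Set.range (ιb Z t) → lamD.toC.toK.layer.Bv (lamD.toC.toK.emb Z t φ B) b' = 0)
    (hχsupp : ∀ Z, ∀ t ∈ terms (θ.ℓ₆ + 1) (lamD.toC.toK.layer.m₃ + 1) Z, ∀ φ ∈ lamD.toC.toK.layer.sp2 Z, ∀ B, lamD.toC.toK.chiY₀ Z t B ≠ 0 → ∀ Y ∈ t.1,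
      lamD.toC.toK.emb Z t φ B ∈ lamD.toC.toK.layer.sp1 Y)
    -- (3) measurability of the layer's potentials and small-field region in the bond variables (`χ_{k,Y₀}` of record IS measurable, §0)
    (hVm : ∀ Z t φ Y, Measurable (lamD.toC.toK.Vr Z t φ Y))
    (hsmallm : ∀ Z t φ, MeasurableSet {B : (lamD.toC.toK.𝒦 Z t).Λ → ℝ | ∀ Y ∈ t.1, lamD.toC.toK.emb Z t φ B ∈ lamD.toC.toK.layer.sp1 Y}) {γ₂ : ℝ}
    (hγ₂ : 0 ≤ γ₂)
    -- (3‴) uniform fibre bound of the bond locations AS A LOCATED INEQUALITY (n10-w4 g2 `B13CondTowerLocationNumerals.locNFibreMax`):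
    --      the largest location fibre of the record's `locN` is at most the letter `m` of the (2.24)–(2.26) numerals
    {m : ℕ} (hm : locNFibreMax lamD.toC ≤ m)
    -- (3) THE REFERENCE RUNG ON THE TERMS OF THE STEP OF RECORD (the displayed hypothesis, n10-b's reference currency):
    --     ONE admissible reference package `rf`, an accretivity radius `0 < R₁ < R`, print's two perturbative sources (p. 15:
    --     «O(1)e^{−⅓δ₀M} + O(α₀ + α₁)» against the reference positivity) as FOUR DIVISION-FREE THRESHOLDS, positive input
    --     rates and `η ≤ etaMax` of the W-walks package `rf.toWalkPackage R₁` (standard rate book: `κ_C = κ_C⋆`, `ρ′ = μ∕4`),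
    --     `TermWalksRef` for the kernels of every term, round letters, and PRINT's TWO EXCHANGE THRESHOLDS for a `θ₀ > 0`
    (rf : RefPackage) (hrf : rf.Admissible)
    -- (2″) THE RUNG's TWO DIALS AS n10-w3's LOCATED NUMERALS (`B13RungDialNumerals`): the accretivity radius IS `R₁⋆(rf)` and the exchange
    --      letter IS `θ₀max` (n10-w1) — stated as EQUATION binders (discharge by `rfl`) so that the package numerals stay short
    {R₁ : ℝ} (hR₁def : R₁ = radiusStar rf.R rf.m₀ rf.mA₀ rf.KbarP rf.KbarA rf.cV rf.cV₀)
    (hp : (rf.toWalkPackage R₁).PositiveRates) (hη : rf.η ≤ (rf.toWalkPackage R₁).etaMax)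
    {θ₀ : ℝ} (hθ₀def : θ₀ = theta0Max m lamD.toC.toK.ν (rf.toWalkPackage R₁).kapCStar (rf.toWalkPackage R₁).Kbar (8 / rf.mA₀) (2 / rf.mA₀)
      (rf.toWalkPackage R₁).BΓ rf.cV (B6.c0 1 rf.η) rf.mA₀)
    -- (2″) PRINT's TWO PERTURBATIVE SOURCES AS TWO LOCATED INEQUALITIES: «|A′|, |𝐉| small» ([II] p. 15) and «σ-cubes far from Z₀» (p. 13)
    (hαloc : α ≤ alphaMax θ₀ R₁ (rf.toWalkPackage R₁).Kbar)
    (hRσloc : rsigmaMin θ₀ (rf.toWalkPackage R₁).Kbar (rf.toWalkPackage R₁).mu (rf.toWalkPackage R₁).kapCStar rf.m₀ rf.mA₀ rf.KbarP rf.KbarA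
      rf.cV rf.cV₀ rf.εP rf.εA ≤ rf.Rσ)
    -- (3) NODE A's KERNEL DATA READ OFF ONE OPERATOR PER TERM — print's `C*Δ_k(σ(Z),𝐔,𝐉)C` after the conditioning (2.5)–(2.6): block
    --     reading; ONE expansion at `rf`'s full-precision letters whose terms are `s`-MONOMIALS times σ-free operators ([II] p. 3) and
    --     carry a WALK REVERSAL ([13] (3.107)); ONE positivity; geometry; dominations in `rf`
    (hKX : ∀ Z, ∀ t ∈ terms (θ.ℓ₆ + 1) (lamD.toC.toK.layer.m₃ + 1) Z, (lamD.toC.toK.𝒦 Z t).X.Nonempty)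
    -- (3″) NODE A's OBJECT DATA AS ENTRYWISE LETTERS (census v5 class A2′ in its ENTRYWISE form ∧ A2″ as ONE geometric letter ∧ A2‴; replaces
    --      module 21's `hKexp`; ym-nodeO-ideate P2 g30's reduction, tree module `B13EntrywiseWalks`): per term, the fine-bond index `lamD.P Z t` located by
    --      `locF`; TWO ENTRYWISE LETTERS of the σ-free fluctuation operator `lamD.Δ₀ Z t` on the complex `rf.R`-ball — (3.108)-type decay
    --      `‖Δ₀(u)_{ij}‖ ≤ B·e^{−ρ·d₁(i,j)}` and entrywise holomorphy (`RawEntryLetters`) —, a fibre bound; the cube decoration `J` on PAIRS of fine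
    --      bonds with the GEODESIC letter (`|J(i,j)| ≤ c₀ + d₁(i,j)∕M₁`, a decorated pair joined by a `d₁`-geodesic through `(lamD.toC.toK.𝒦 Z t).X`); the (1.11)
    --      numerics `0 < η ≤ ε < ρ`, `2κ₁ ≤ ηM₁`; the REAL constant local averaging operator `lamD.Cm Z t` of (2.5) (`|C| ≤ 1`, range `rC`); a junction
    --      rate `μΔ`; the letter match with `rf`; and `lamD.toC.KK Z t` IS `Cᵀ·sDecorate(J′, ½raw ⊕ ½rawᵀ)·C` (`hKK`)
    {ρΔ BΔ ηΔ μΔ M₁ rC : ℝ} {mF c₀ : ℕ}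
    (hEL : ∀ Z, ∀ t ∈ terms (θ.ℓ₆ + 1) (lamD.toC.toK.layer.m₃ + 1) Z, RawEntryLetters (lamD.Δ₀ Z t) (lamD.locF Z t) rf.R ρΔ BΔ)
    -- (3‴) the fine-bond fibre bound AS A LOCATED INEQUALITY (`B13CondTowerLocationNumerals.locFFibreMax`)
    (hmF : locFFibreMax lamD ≤ mF)
    -- (3‴) the cube decoration's geodesic letter `hGJ` AS ITS TWO LAWS (symmetry of `J`; a decorated pair is joined by a `d₁`-geodesic through the
    --      σ-region `X`) + ONE LOCATED INEQUALITY on the cardinal excess (`B13CondTowerLocationNumerals.decorExcess`); the slope `0 < M₁` is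
    --      derived below from `hκ₁ hκp hP2 hηΔ` (no binder)
    (hsymm : ∀ (Z : TDom 4 (lamD.n + 1)) (t : B13TermIdx θ lamD.n lamD.m₃) (i j : lamD.P Z t), lamD.J Z t (j, i) = lamD.J Z t (i, j))
    (hthrough : ∀ (Z : TDom 4 (lamD.n + 1)) (t : B13TermIdx θ lamD.n lamD.m₃) (i j : lamD.P Z t), (lamD.J Z t (i, j)).Nonempty →
      ∃ z ∈ lamD.X Z t, tdist1 lamD.Nf (lamD.locF Z t i) z + tdist1 lamD.Nf z (lamD.locF Z t j)
        ≤ tdist1 lamD.Nf (lamD.locF Z t i) (lamD.locF Z t j))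
    (hc₀ : decorExcess lamD M₁ ≤ c₀)
    (hηΔ : 0 < ηΔ) (hP2 : 2 * cp.κ₁ ≤ ηΔ * M₁)
    -- (3‴) the averaging operator's size and range AS TWO LOCATED INEQUALITIES (`B13CondTowerLocationNumerals.cmAbsMax ∕ cmRange`)
    (hCmax : (cmAbsMax lamD : ℝ) ≤ 1)
    (hrC : (cmRange lamD : ℝ) ≤ rC) (hμΔ : 0 < μΔ)
    -- (3″) THE (1.11) NUMERICS + JUNCTION-RATE CHAIN AS n10-w3's LOCATED NUMERALS (`B13EntrywiseBlockNumerals`, dial form):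
    --      ONE rate budget and ONE floor replace `εΔ κΔ hηε hρε hμε hμκ hκεΔ hεP hkapP hKP`
    (hbudget : ηΔ + rf.εP + rf.kapP + 4 * μΔ ≤ ρΔ)
    (hkbar : kbarFloor lamD.toC.toK.ν mF c₀ ρΔ ηΔ μΔ rC cp.κ₁ BΔ ≤ rf.KbarP)
    -- (3‴) THE ONE POSITIVITY `hKacc` AS A LOCATED INEQUALITY (n10-w4 g3 `B13CondTowerAccretiveFloorMax.accretiveFloorMax`, the OPTIMAL floor):
    --      the rung's reference margin `rf.m₀` is at most the LARGEST uniform real Rayleigh floor of the record's positive definite reference values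
    --      `K₀ Z t` — EQUIVALENT to the real-floor form of `hKacc` (`le_accretiveFloorMax_iff`); any known uniform floor `γ ≥ rf.m₀` discharges it
    (hm₀ : rf.m₀ ≤ accretiveFloorMax lamD.toC)
    -- (3‴) the far-ness `hKfar` and the multiplicity `hKmult` AS LOCATED INEQUALITIES (`B13CondTowerLocationNumerals.sigmaDistFloor ∕ locNFibreMax`)
    (hRσfloor : rf.Rσ ≤ sigmaDistFloor lamD.toC)
    (hnB : locNFibreMax lamD.toC ≤ rf.nB)
    (hKdim : lamD.toC.toK.ν ≤ rf.dm) (hεL : rf.εL ≤ rf.εP) (hκL : rf.kapL ≤ rf.kapP) (hKL : rf.KbarP ≤ rf.KbarL) (hεA : rf.εA ≤ rf.εP)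
    (hκA : rf.kapA ≤ rf.kapP) (hKA : rf.KbarP ≤ rf.KbarA) (hmA : rf.mA₀ ≤ rf.m₀)
    -- (3) THE (2.24)–(2.25) SMALLNESS AS n10-w1's THREE LOCATED NUMERALS (`B13Bound226Numerals`: canonical rate chain `j·κ_C⋆∕5`,
    --     `ϑ := theta`, `K_G := K̄`, `K_Cs := 8∕m_{A,0}`, `c_E := 2∕m_{A,0}`): `θ₀ ≤ θ₀max`, `γ₂ ≤ γ₂max`, `M⁴min ≤ M⁴`
    (hγle : γ₂ ≤ gamma2Max m lamD.toC.toK.ν (2 / rf.mA₀) (rf.toWalkPackage R₁).BΓ rf.cV (B6.c0 1 rf.η) rf.mA₀)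
    (hM4 : m4Min m lamD.toC.toK.ν m' (2 / rf.mA₀) (rf.toWalkPackage R₁).BΓ rf.cV (B6.c0 1 rf.η) rf.mA₀ lamD.toC.toK.layer.c.α₄ lamD.toC.toK.layer.c.κ₁ ≤ lamD.toC.toK.layer.c.M ^ 4)
    -- (3) constant matching, p. 17: `a ≤ γ₂ r_P²` and the volume factor with `w = 2·K₀(64,8)·α₄·#(⋃𝐃)`
    (hPa : a ≤ γ₂ * lamD.toC.toK.rP ^ 2)
    -- (3) the volume factor in θ-FREE COUNT FORM (`B13Bound226Numerals.vol_of_counts`): `2|Λ| + ½|Λ ⊕ C₀| + 2K₀(64,8)α₄·#⋃𝐃 ≤ a₅|Z|`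
    (hcount : ∀ Z, ∀ t ∈ terms (θ.ℓ₆ + 1) (lamD.toC.toK.layer.m₃ + 1) Z,
      2 * (Fintype.card (lamD.toC.toK.𝒦 Z t).Λ : ℝ) + (Fintype.card ((lamD.toC.toK.𝒦 Z t).Λ ⊕ (lamD.toC.toK.𝒦 Z t).C₀) : ℝ) / 2
        + 2 * (K₀ 64 8 * lamD.toC.toK.layer.c.α₄ * ((((t.1).image Subtype.val).biUnion id).card : ℝ)) ≤ a₅ * ((Z.1).card : ℝ)) :
    B13LeafOfRecord θ lamD.toC.toK.layer := by
  -- the decoration slope is positive: `0 < 1 + 2·log(8·12³) ≤ κ₁ < cp.κ₁` and `2·cp.κ₁ ≤ η_Δ·M₁` with `0 < η_Δ`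
  have hM₁ : 0 < M₁ := by
    have hlog : 0 ≤ Real.log (8 * 12 ^ 3) := Real.log_nonneg (by norm_num)
    have hpos : 0 < ηΔ * M₁ := by linarith
    nlinarith
  -- the eight located binders of 67RD from the ten located inequalities ∕ laws (n10-w4 g2 supply lemmas BY NAME), then 67RD positionally
  exact b13LeafOfRecord_decLayer_of_located_entrywise_numerals_dials θ lamD
    hN12 dist hS0Y hFsub hSq hScY hdist0 hdist hSX hSX' hX0 hAnT hAnT' hK hK' hκ hδ1 hδκ hκ126 hκ126' hκ₁ hκ₁' hδ₀M hδ₀M5 hR8 hR9 h124 h130 hθ₁0 hθ₁1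
    hC hGlAn hGl he hg hK₂ hR hε3 hW hKW hcard hsp hfloor hAnP hG hL8 hN h12 hE hε hC₁ hα hM hτ2 cp hκp hr hr1 hαnn huα hPcard ιb hι cube hQsupp hfibc
    hBv hBv0 hχsupp hVm hsmallm hγ₂ (hfibN_decTower_of_le lamD hm) rf hrf hR₁def hp hη hθ₀def hαloc hRσloc hKX hEL (hfibF_of_locFFibreMax_le lamD hmF)
    (hGJ_of_laws_of_decorExcess_le lamD hsymm hthrough hM₁ hc₀) hηΔ hP2 (hCle_of_cmAbsMax_le_one lamD hCmax) (hCsupp_of_cmRange_le lamD hrC) hμΔ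
    hbudget hkbar (hKacc_decTower_of_le_accretiveFloorMax lamD hm₀) (hKfar_decTower_of_le lamD rf hRσfloor) (hKmult_decTower_of_le lamD rf hnB) hKdim
    hεL hκL hKL hεA hκA hKA hmA hγle hM4 hPa hcount

end DecLayer

end Summit.QuantumFields.YangMills.BalabanUVNodes.N10B13KernelTowerWalksEntrywiseNumeralsDecoratedDialsLocated

end
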